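import Summits.AtomisticToContinuum.HydrodynamicLimit.Theorems.LambertianContactSwapContactAngleEquidistributionFibreCentring
import Summits.AtomisticToContinuum.HydrodynamicLimit.Theorems.LambertianContactSwapContactAngleEquidistributionNearFieldBall
import HarnessLib

/-!
# Fibrewise exactness of the ADMISSIBLE-conditioned cosine centring in midpoint coordinates
# (stub `stub_fibreAdmissible` of line `Sketch`, skeleton v4, crux `LambertianContactSwap.ContactAngleEquidistribution`,
# stmt-AtomisticToContinuum-12097)

Support file (`--supports`) for "T1 is EXACT in equilibrium" (skeleton v4 of line `Sketch`): the near-field stratum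
(a third centre within `3ε` of the contact midpoint) of the speed-capped, `|g|²`-weighted contact-angle functional,
centred by the cosine law CONDITIONED ON THE ADMISSIBLE NORMALS of the actual environment
(`admissibleCosineMean (admissibleNormalsBall …)`, tree files `…NearFieldTools`, `…NearFieldBall`), has equilibrium
mean zero for every `N`. After Campbell's formula and the change of variables of the outgoing contact flux to incoming
midpoint / normal coordinates (CIP 1994 App. 4.A pp. 107–111; tree `stub_campbellTimeDep`, `stub_fluxMidpoint`) this
is, for every configuration `z` of the other data, the equality of the two sphere integrals of `stub_fibreAdmissible`
(positive and negative parts of the real mark on the fibre `ω ↦ mid ω`: particle `i` at `c + (ε/2)ω`, particle `j` at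
`c − (ε/2)ω`, `c = x_j`, velocities unchanged); companion of `stub_fibreCentring` (isolated stratum, `…FibreCentring`).

WHY the two sphere integrals agree, for EVERY `z`:
* on the fibre the pair separation is `εω`, the contact midpoint is `c`; the ball selector `near` and the speed cap
  are `ω`-free (as in `…FibreCentring`), and so is the admissible set `A := admissibleNormalsBall ε (mid ω) i j c`,
  which only reads the OTHER particles, those of `z`;
* NEW POINT: on the ball the hard-core indicator FACTORISES along the fibre, `1_D(mid ω) = 1_{D₀}(z) · 1_A(ω)`,
  `D₀` = "all pairs among the particles other than `i, j` are `ε`-separated" (`ω`-free), `ω ∈ A` being literally the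
  statement that the colliders at `c ± (ε/2)ω` are `ε`-separated from every third particle (the pair itself is at `ε`);
* the homogeneous Gibbs weight only sees the velocities (`tensorPow_localGibbsProfile_const`);
* what is left is `W(z) ∫_{S²} (ε²⟪ω, −g⟫)₊ (|g|² m_A(ω))^± dω`, `m_A = 1_A (f − admissibleCosineMean A g f)`,
  `f = ψ s c vᵢ vⱼ`, and `∫_{S²} ⟪ω, −ĝ⟫₊ 1_A(ω)(f ω − admissibleCosineMean A g f) dω = 0`: by the real half-angle
  law (`integral_lambertDir_stdGaussian_real`) numerator and denominator of the conditioned mean are `π⁻¹ I_f`,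
  `π⁻¹ I_1`, `I_h := ∫_{S²} ⟪θ, −ĝ⟫₊ 1_A h dσ`, so the integral is `I_f − I_1 (I_f/I_1) = 0` if `I_1 ≠ 0`, while if
  `I_1 = 0` the mean is the junk value `0` and the flux `⟪·, −ĝ⟫₊ 1_A` vanishes a.e., whence `I_f = 0` too.

References: C. Cercignani, R. Illner, M. Pulvirenti, *The Mathematical Theory of Dilute Gases*, Springer (1994),
App. 4.A pp. 107–111 (contact coordinates); the half-angle law is the tree's (`…ContactAngleEquidistributionCentring`).
-/

noncomputable section

open MeasureTheory Filter Set Topology ProbabilityTheory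
open scoped ENNReal BigOperators Classical RealInnerProductSpace

namespace Summit.AtomisticToContinuum.HydrodynamicLimit.Theorems.ContactAngleEquidistributionSketch

open Literature.Analysis.FluidPDE Literature.MathematicalPhysics.KineticTheory

/-! ### The admissible-conditioned cosine mean in flux form -/

/-- The cosine flux `θ ↦ ⟪θ, ν⟫₊ h θ` of a bounded measurable real mark through the unit sphere is integrable
(bounded on a finite measure space). [folklore] -/
theorem fibreAdm_integrable_cosFlux {ν : V3} (hν : ‖ν‖ = 1) {h : V3 → ℝ} (hm : Measurable h) {C : ℝ}
    (hb : ∀ x, |h x| ≤ C) :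
    Integrable (fun θ : Metric.sphere (0 : V3) 1 => max ⟪(θ : V3), ν⟫ 0 * h θ) (volume : Measure V3).toSphere :=
  Integrable.of_bound ((measurable_posInner_sphere ν).fun_mul (hm.comp continuous_subtype_val.measurable)).aestronglyMeasurable
    C (Eventually.of_forall fun θ => by
      rw [norm_mul, Real.norm_of_nonneg (le_max_right _ _), Real.norm_eq_abs]
      calc max ⟪(θ : V3), ν⟫ 0 * |h θ| ≤ 1 * C :=
            mul_le_mul (posInner_sphere_le_one hν θ) (hb _) (abs_nonneg _) zero_le_one
        _ = C := one_mul _)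

/-- **Flux form of a Lambert-sampled, `A`-restricted mark.** For `g ≠ 0`, a measurable set of normals `A` and a
bounded measurable real mark `φ`, `∫ [lambertDir(−g) ξ ∈ A] φ(lambertDir(−g) ξ) dγ(ξ) = π⁻¹ ∫_{S²} ⟪θ, −ĝ⟫₊ [θ ∈ A] φ θ dσ(θ)`:
the real half-angle law `integral_lambertDir_stdGaussian_real` for the mark `1_A φ`, the sampler only seeing the
direction of `−g` (`lambertDir_smul_left`). [folklore] -/
theorem fibreAdm_integral_ite_lambertDir {g : V3} (hg : g ≠ 0) {A : Set V3} (hA : MeasurableSet A)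
    {φ : V3 → ℝ} (hφm : Measurable φ) {C : ℝ} (hφb : ∀ x, |φ x| ≤ C) :
    ∫ ξ, (if lambertDir (-g) ξ ∈ A then φ (lambertDir (-g) ξ) else 0) ∂(stdGaussian V3) =
      Real.pi⁻¹ * ∫ θ : Metric.sphere (0 : V3) 1, max ⟪(θ : V3), -(‖g‖⁻¹ • g)⟫ 0 *
        (if (θ : V3) ∈ A then φ θ else 0) ∂(volume : Measure V3).toSphere := by
  have hgn : 0 < ‖g‖ := norm_pos_iff.2 hg
  have hν : ‖-(‖g‖⁻¹ • g)‖ = 1 := by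
    rw [norm_neg, norm_smul, Real.norm_of_nonneg (inv_nonneg.2 hgn.le), inv_mul_cancel₀ hgn.ne']
  have hdir : ∀ ξ, lambertDir (-g) ξ = lambertDir (-(‖g‖⁻¹ • g)) ξ := fun ξ => by
    rw [show -(‖g‖⁻¹ • g) = ‖g‖⁻¹ • (-g) from (smul_neg _ _).symm, lambertDir_smul_left (inv_pos.2 hgn)]
  have hC : 0 ≤ C := (abs_nonneg _).trans (hφb 0)
  have hm : Measurable fun m : V3 => if m ∈ A then φ m else 0 := Measurable.ite hA hφm measurable_const
  have hb : ∀ m : V3, |(if m ∈ A then φ m else 0)| ≤ C := fun m => by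
    split_ifs; exacts [hφb m, by rw [abs_zero]; exact hC]
  simp_rw [hdir]
  exact integral_lambertDir_stdGaussian_real hν hm hb

/-- **The admissible-conditioned centring identity.** For `g ≠ 0`, a measurable set of normals `A` and a bounded
measurable real mark `f`, the cosine flux THROUGH `A` of the mark centred by its admissible-conditioned cosine mean
vanishes: `∫_{S²} ⟪θ, −ĝ⟫₊ [θ ∈ A] (f θ − admissibleCosineMean A g f) dσ(θ) = 0`. With
`I_h := ∫_{S²} ⟪θ, −ĝ⟫₊ [θ ∈ A] h θ dσ` the mean is `(π⁻¹ I_f)/(π⁻¹ I_1)` (`fibreAdm_integral_ite_lambertDir`), so the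
integral is `I_f − (I_f/I_1) I_1 = 0` when `I_1 ≠ 0`; when `I_1 = 0` the mean is the junk value `0` and the flux
`⟪·, −ĝ⟫₊ 1_A` vanishes a.e., whence `I_f = 0` too. [folklore] -/
theorem fibreAdm_integral_cosFlux_ite_sub_admissibleCosineMean_eq_zero {g : V3} (hg : g ≠ 0) {A : Set V3}
    (hA : MeasurableSet A) {f : V3 → ℝ} (hfm : Measurable f) {C : ℝ} (hfb : ∀ x, |f x| ≤ C) :
    ∫ θ : Metric.sphere (0 : V3) 1, max ⟪(θ : V3), -(‖g‖⁻¹ • g)⟫ 0 *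
        (if (θ : V3) ∈ A then f θ - admissibleCosineMean A g f else 0) ∂(volume : Measure V3).toSphere = 0 := by
  have hgn : 0 < ‖g‖ := norm_pos_iff.2 hg
  have hν : ‖-(‖g‖⁻¹ • g)‖ = 1 := by
    rw [norm_neg, norm_smul, Real.norm_of_nonneg (inv_nonneg.2 hgn.le), inv_mul_cancel₀ hgn.ne']
  have hC : 0 ≤ C := (abs_nonneg _).trans (hfb 0)
  -- the restricted marks `1_A f`, `1_A` and their (integrable) fluxes
  have hfA : Measurable fun m : V3 => if m ∈ A then f m else 0 := Measurable.ite hA hfm measurable_const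
  have h1A : Measurable fun m : V3 => if m ∈ A then (1 : ℝ) else 0 := Measurable.ite hA measurable_const measurable_const
  have hfAb : ∀ m : V3, |(if m ∈ A then f m else 0)| ≤ C := fun m => by
    split_ifs; exacts [hfb m, by rw [abs_zero]; exact hC]
  have h1Ab : ∀ m : V3, |(if m ∈ A then (1 : ℝ) else 0)| ≤ 1 := fun m => by split_ifs <;> simp
  have hIf := fibreAdm_integrable_cosFlux hν hfA hfAb
  have hI1 := fibreAdm_integrable_cosFlux hν h1A h1Ab
  -- the admissible-conditioned mean in flux form
  obtain ⟨c, hc⟩ : ∃ c : ℝ, c = admissibleCosineMean A g f := ⟨_, rfl⟩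
  have hD : ∫ ξ, (if lambertDir (-g) ξ ∈ A then (1 : ℝ) else 0) ∂(stdGaussian V3) =
      Real.pi⁻¹ * ∫ θ : Metric.sphere (0 : V3) 1, max ⟪(θ : V3), -(‖g‖⁻¹ • g)⟫ 0 *
        (if (θ : V3) ∈ A then (1 : ℝ) else 0) ∂(volume : Measure V3).toSphere :=
    fibreAdm_integral_ite_lambertDir hg hA (φ := fun _ => (1 : ℝ)) measurable_const (C := 1) fun _ => by norm_num
  have hc' : c = (Real.pi⁻¹ * ∫ θ : Metric.sphere (0 : V3) 1, max ⟪(θ : V3), -(‖g‖⁻¹ • g)⟫ 0 *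
        (if (θ : V3) ∈ A then f θ else 0) ∂(volume : Measure V3).toSphere) /
      (Real.pi⁻¹ * ∫ θ : Metric.sphere (0 : V3) 1, max ⟪(θ : V3), -(‖g‖⁻¹ • g)⟫ 0 *
        (if (θ : V3) ∈ A then (1 : ℝ) else 0) ∂(volume : Measure V3).toSphere) := by
    rw [hc]
    change (∫ ξ, (if lambertDir (-g) ξ ∈ A then f (lambertDir (-g) ξ) else 0) ∂(stdGaussian V3)) /
        (∫ ξ, (if lambertDir (-g) ξ ∈ A then (1 : ℝ) else 0) ∂(stdGaussian V3)) = _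
    rw [fibreAdm_integral_ite_lambertDir hg hA hfm hfb, hD]
  rw [← hc]
  -- split the centred flux into the two fluxes
  have hsplit : ∀ θ : Metric.sphere (0 : V3) 1, max ⟪(θ : V3), -(‖g‖⁻¹ • g)⟫ 0 *
      (if (θ : V3) ∈ A then f θ - c else 0) = max ⟪(θ : V3), -(‖g‖⁻¹ • g)⟫ 0 * (if (θ : V3) ∈ A then f θ else 0) -
        c * (max ⟪(θ : V3), -(‖g‖⁻¹ • g)⟫ 0 * (if (θ : V3) ∈ A then (1 : ℝ) else 0)) := fun θ => by
    split_ifs <;> ring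
  simp_rw [hsplit]
  rw [integral_sub hIf (hI1.const_mul c), integral_const_mul, hc']
  by_cases h1 : ∫ θ : Metric.sphere (0 : V3) 1, max ⟪(θ : V3), -(‖g‖⁻¹ • g)⟫ 0 *
      (if (θ : V3) ∈ A then (1 : ℝ) else 0) ∂(volume : Measure V3).toSphere = 0
  · -- no flux through `A`: the mean is the junk value `0` and the flux of `1_A f` vanishes as well
    rw [h1]
    simp only [mul_zero, sub_zero]
    have hae := (integral_eq_zero_iff_of_nonneg (fun θ => mul_nonneg (le_max_right _ _)
      (by split_ifs <;> norm_num)) hI1).1 h1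
    refine integral_eq_zero_of_ae (hae.mono fun θ hθ => ?_)
    have hθ' : max ⟪(θ : V3), -(‖g‖⁻¹ • g)⟫ 0 * (if (θ : V3) ∈ A then (1 : ℝ) else 0) = 0 := hθ
    show max ⟪(θ : V3), -(‖g‖⁻¹ • g)⟫ 0 * (if (θ : V3) ∈ A then f θ else 0) = 0
    by_cases hθA : (θ : V3) ∈ A
    · rw [if_pos hθA, mul_one] at hθ'
      rw [hθ', zero_mul]
    · rw [if_neg hθA, mul_zero]
  · rw [mul_div_mul_left _ _ (inv_ne_zero Real.pi_pos.ne'), div_mul_cancel₀ _ h1, sub_self]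

/-! ### Positive and negative parts of a cosine flux of zero mean -/

/-- **A cosine flux of zero real mean has positive and negative parts of equal mass.** For `g : V3`, a bounded
measurable real `m` with `∫_{S²} ⟪ω, −ĝ⟫₊ m(ω) dω = 0` (only required for `g ≠ 0`) and `a ≥ 0`,
`∫⁻_{S²} (a⟪ω, −g⟫)₊ (|g|² m(ω))⁺ dω = ∫⁻_{S²} (a⟪ω, −g⟫)₊ (|g|² m(ω))⁻ dω`: both sides are `ofReal` of integrable
functions whose difference `a|g|³ ⟪ω, −ĝ⟫₊ m(ω)` integrates to `0`; for `g = 0` both vanish. [folklore]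
-- adapted from `fibre_lintegral_cosFlux_mark_pos_eq_neg` (`…FibreCentring`), the centring made a hypothesis -/
theorem fibreAdm_lintegral_cosFlux_pos_eq_neg {g : V3} {m : V3 → ℝ} (hmm : Measurable m) {C : ℝ}
    (hmb : ∀ x, |m x| ≤ C) {a : ℝ} (ha : 0 ≤ a)
    (h0 : g ≠ 0 → ∫ θ : Metric.sphere (0 : V3) 1, max ⟪(θ : V3), -(‖g‖⁻¹ • g)⟫ 0 * m θ
      ∂(volume : Measure V3).toSphere = 0) :
    ∫⁻ ω : Metric.sphere (0 : V3) 1, ENNReal.ofReal (a * ⟪(ω : V3), -g⟫) *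
        ENNReal.ofReal (‖g‖ ^ 2 * m ω) ∂(volume : Measure V3).toSphere =
    ∫⁻ ω : Metric.sphere (0 : V3) 1, ENNReal.ofReal (a * ⟪(ω : V3), -g⟫) *
        ENNReal.ofReal (-(‖g‖ ^ 2 * m ω)) ∂(volume : Measure V3).toSphere := by
  by_cases hg : g = 0
  · subst hg
    simp
  have hgn : 0 < ‖g‖ := norm_pos_iff.2 hg
  have hν : ‖-(‖g‖⁻¹ • g)‖ = 1 := by
    rw [norm_neg, norm_smul, Real.norm_of_nonneg (inv_nonneg.2 hgn.le), inv_mul_cancel₀ hgn.ne']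
  -- the cosine weight `(a⟪ω, -g⟫)₊ = a‖g‖ ⟪ω, -ĝ⟫₊` inside `ofReal`
  have hcos : ∀ ω : Metric.sphere (0 : V3) 1, ENNReal.ofReal (a * ⟪(ω : V3), -g⟫) =
      ENNReal.ofReal (a * ‖g‖ * max ⟪(ω : V3), -(‖g‖⁻¹ • g)⟫ 0) := by
    intro ω
    have h1 : ⟪(ω : V3), -g⟫ = ‖g‖ * ⟪(ω : V3), -(‖g‖⁻¹ • g)⟫ := by
      rw [inner_neg_right, inner_neg_right, inner_smul_right, mul_neg, ← mul_assoc, mul_inv_cancel₀ hgn.ne', one_mul]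
    rw [h1, ← mul_assoc]
    rcases le_total 0 ⟪(ω : V3), -(‖g‖⁻¹ • g)⟫ with h | h
    · rw [max_eq_left h]
    · rw [max_eq_right h, mul_zero, ENNReal.ofReal_zero,
        ENNReal.ofReal_of_nonpos (mul_nonpos_of_nonneg_of_nonpos (mul_nonneg ha hgn.le) h)]
  have hK : 0 ≤ a * ‖g‖ := mul_nonneg ha hgn.le
  have hL : ∀ ω : Metric.sphere (0 : V3) 1, ENNReal.ofReal (a * ⟪(ω : V3), -g⟫) * ENNReal.ofReal (‖g‖ ^ 2 * m ω) =
      ENNReal.ofReal (a * ‖g‖ * ‖g‖ ^ 2 * (max ⟪(ω : V3), -(‖g‖⁻¹ • g)⟫ 0 * m ω)) := by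
    intro ω
    rw [hcos ω, ← ENNReal.ofReal_mul (mul_nonneg hK (le_max_right _ _))]
    congr 1
    ring
  have hR : ∀ ω : Metric.sphere (0 : V3) 1, ENNReal.ofReal (a * ⟪(ω : V3), -g⟫) * ENNReal.ofReal (-(‖g‖ ^ 2 * m ω)) =
      ENNReal.ofReal (-(a * ‖g‖ * ‖g‖ ^ 2 * (max ⟪(ω : V3), -(‖g‖⁻¹ • g)⟫ 0 * m ω))) := by
    intro ω
    rw [hcos ω, ← ENNReal.ofReal_mul (mul_nonneg hK (le_max_right _ _))]
    congr 1
    ring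
  rw [lintegral_congr hL, lintegral_congr hR]
  refine fibre_lintegral_ofReal_eq_lintegral_ofReal_neg ((fibreAdm_integrable_cosFlux hν hmm hmb).const_mul _) ?_
  rw [integral_const_mul, h0 hg, mul_zero]

/-! ### The stub -/

/-- **Fibrewise exactness of the admissible-conditioned cosine centring in midpoint coordinates** (stub
`stub_fibreAdmissible` of line `Sketch` v4). For `0 < ε < 1/2`, `i ≠ j`, an admissible mark `ψ` (jointly measurable,
`|ψ| ≤ 1`) and EVERY configuration `z`, the sphere integrals over the normal `ω` of the cosine flux `(ε²⟪ω, v_j − v_i⟫)₊`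
times `1_D ρ (mark)^±` read on the fibre `mid ω` (particle `i` at `x_j + (ε/2)ω`, particle `j` at `x_j − (ε/2)ω`,
velocities unchanged) coincide, the mark being the NEAR-FIELD (midpoint-ball), speed-capped, `|g|²`-weighted
contact-angle mark centred by the cosine mean conditioned on the admissible normals of the actual environment. On the
fibre the pair separation is `εω`, the contact midpoint is `x_j`; the ball selector, the speed cap, the admissible set
`A` (it only reads the other particles) and the homogeneous Gibbs weight are `ω`-free, the hard-core indicator
factorises as `1_{D₀}(z) 1_A(ω)`, and the remaining `ω`-integral is the admissible-conditioned centring identity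
`fibreAdm_integral_cosFlux_ite_sub_admissibleCosineMean_eq_zero`. [cite: CIP1994, App. 4.A pp. 107–111] -/
theorem stub_fibreAdmissible {n : ℕ} {ε : ℝ} (hε0 : 0 < ε) (hε : ε < 1 / 2) {i j : Fin n} (hij : i ≠ j)
    (θe s V : ℝ) (ψ : ℝ → T3 → V3 → V3 → V3 → ℝ)
    (hψm : Measurable fun p : ℝ × T3 × V3 × V3 × V3 => ψ p.1 p.2.1 p.2.2.1 p.2.2.2.1 p.2.2.2.2)
    (hψb : ∀ s x v w m, |ψ s x v w m| ≤ 1) (z : Config n (Fin 3) T3) :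
    let G := Torus.geometry (Fin 3)
    let xmid : Config n (Fin 3) T3 → T3 := fun y => G.translate (y j).1 ((2 : ℝ)⁻¹ • G.sepVec (y i).1 (y j).1)
    let near : Config n (Fin 3) T3 → Prop := fun y =>
      ∃ k : Fin n, k ≠ i ∧ k ≠ j ∧ ‖G.sepVec (y k).1 (xmid y)‖ ≤ 3 * ε
    let mark : Config n (Fin 3) T3 → ℝ := fun y =>
      if near y then
        (if V < ‖(y i).2 - (y j).2‖ then 0 else
          ‖(y i).2 - (y j).2‖ ^ 2 * (ψ s (xmid y) (y i).2 (y j).2 (ε⁻¹ • G.sepVec (y i).1 (y j).1) -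
            admissibleCosineMean (admissibleNormalsBall ε y i j (xmid y)) ((y i).2 - (y j).2)
              (ψ s (xmid y) (y i).2 (y j).2)))
      else 0
    let ρ : Config n (Fin 3) T3 → ℝ≥0∞ := fun y =>
      ENNReal.ofReal (canonicalDensity G ε n (localGibbsProfile (fun _ => 1) (fun _ => 0) (fun _ => θe)) y)
    let mid : V3 → Config n (Fin 3) T3 := fun ω =>
      Function.update (Function.update z i
          ((z j).1 + Literature.Analysis.FunctionSpaces.Torus.proj ((ε / 2) • ω), (z i).2)) j
        ((z j).1 + Literature.Analysis.FunctionSpaces.Torus.proj (-((ε / 2) • ω)), (z j).2)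
    ∫⁻ ω : Metric.sphere (0 : V3) 1,
        ENNReal.ofReal (ε ^ (Fintype.card (Fin 3) - 1) * ⟪((ω : V3)), (z j).2 - (z i).2⟫) *
          (hardSphereDomain G n ε).indicator (fun y => ρ y * ENNReal.ofReal (mark y)) (mid ω)
        ∂(volume : Measure V3).toSphere =
      ∫⁻ ω : Metric.sphere (0 : V3) 1,
        ENNReal.ofReal (ε ^ (Fintype.card (Fin 3) - 1) * ⟪((ω : V3)), (z j).2 - (z i).2⟫) *
          (hardSphereDomain G n ε).indicator (fun y => ρ y * ENNReal.ofReal (-mark y)) (mid ω)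
        ∂(volume : Measure V3).toSphere := by
  intro G xmid near mark ρ mid
  /- (0) reading the fibre configuration `mid ω` -/
  have hmi : ∀ w : V3, mid w i = ((z j).1 + Literature.Analysis.FunctionSpaces.Torus.proj ((ε / 2) • w), (z i).2) :=
    fun w => by show Function.update (Function.update z i _) j _ i = _; rw [Function.update_of_ne hij, Function.update_self]
  have hmj : ∀ w : V3, mid w j = ((z j).1 + Literature.Analysis.FunctionSpaces.Torus.proj (-((ε / 2) • w)), (z j).2) :=
    fun w => by show Function.update (Function.update z i _) j _ j = _; rw [Function.update_self]
  have hmk : ∀ (w : V3) (k : Fin n), k ≠ i → k ≠ j → mid w k = z k := fun w k hki hkj => by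
    show Function.update (Function.update z i _) j _ k = z k
    rw [Function.update_of_ne hkj, Function.update_of_ne hki]
  have hmv : ∀ (w : V3) (k : Fin n), (mid w k).2 = (z k).2 := fun w k => by
    by_cases hki : k = i
    · rw [hki, hmi]
    · by_cases hkj : k = j
      · rw [hkj, hmj]
      · rw [hmk w k hki hkj]
  /- (1) on the fibre the pair separation is `εω` and the contact midpoint is `x_j` -/
  have hω1 : ∀ ω : Metric.sphere (0 : V3) 1, ‖(ω : V3)‖ = 1 := fun ω => norm_eq_of_mem_sphere ω
  have hab : ∀ ω : Metric.sphere (0 : V3) 1, (ε / 2) • (ω : V3) - -((ε / 2) • (ω : V3)) = ε • (ω : V3) := fun ω => by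
    rw [sub_neg_eq_add, ← add_smul, add_halves]
  have hsep : ∀ ω : Metric.sphere (0 : V3) 1, G.sepVec (mid ω i).1 (mid ω j).1 = ε • (ω : V3) := by
    intro ω
    rw [hmi, hmj, ← hab ω]
    exact fibre_sepVec_add_proj_add_proj (by rw [hab, norm_smul, Real.norm_of_nonneg hε0.le, hω1, mul_one]; exact hε)
  have hεn : ∀ ω : Metric.sphere (0 : V3) 1, ‖G.sepVec (mid ω i).1 (mid ω j).1‖ = ε := fun ω => by
    rw [hsep ω, norm_smul, Real.norm_of_nonneg hε0.le, hω1, mul_one]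
  have hεn' : ∀ ω : Metric.sphere (0 : V3) 1, ‖G.sepVec (mid ω j).1 (mid ω i).1‖ = ε := fun ω => by
    rw [← hεn ω]
    exact Torus.euclidDist_comm _ _
  have hxmid : ∀ ω : Metric.sphere (0 : V3) 1, xmid (mid ω) = (z j).1 := by
    intro ω
    show G.translate (mid ω j).1 ((2 : ℝ)⁻¹ • G.sepVec (mid ω i).1 (mid ω j).1) = (z j).1
    rw [hsep ω, hmj]
    show (z j).1 + Literature.Analysis.FunctionSpaces.Torus.proj (-((ε / 2) • (ω : V3))) +
      Literature.Analysis.FunctionSpaces.Torus.proj ((2 : ℝ)⁻¹ • (ε • (ω : V3))) = (z j).1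
    have h2 : -((ε / 2) • (ω : V3)) + (2 : ℝ)⁻¹ • (ε • (ω : V3)) = 0 := by
      rw [smul_smul, show (2 : ℝ)⁻¹ * ε = ε / 2 by ring, neg_add_cancel]
    rw [add_assoc, ← Literature.Analysis.FunctionSpaces.Torus.proj_add, h2,
      Literature.Analysis.FunctionSpaces.Torus.proj_zero, add_zero]
  /- (2) the midpoint-ball selector is `ω`-free -/
  have hnear : ∀ ω : Metric.sphere (0 : V3) 1,
      near (mid ω) ↔ ∃ k : Fin n, k ≠ i ∧ k ≠ j ∧ ‖G.sepVec (z k).1 (z j).1‖ ≤ 3 * ε := by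
    intro ω
    show (∃ k : Fin n, k ≠ i ∧ k ≠ j ∧ ‖G.sepVec (mid ω k).1 (xmid (mid ω))‖ ≤ 3 * ε) ↔ _
    rw [hxmid ω]
    exact exists_congr fun k => ⟨fun ⟨hki, hkj, hk⟩ => ⟨hki, hkj, by rwa [hmk _ k hki hkj] at hk⟩,
      fun ⟨hki, hkj, hk⟩ => ⟨hki, hkj, by rwa [hmk _ k hki hkj]⟩⟩
  /- (3) the admissible set on the fibre is `ω`-free (it only reads the other particles) and measurable -/
  obtain ⟨A, hAdef⟩ : ∃ A : Set V3, A = admissibleNormalsBall ε z i j (z j).1 := ⟨_, rfl⟩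
  have hAfib : ∀ ω : Metric.sphere (0 : V3) 1, admissibleNormalsBall ε (mid ω) i j (xmid (mid ω)) = A := by
    intro ω
    rw [hAdef]
    ext ν
    simp only [admissibleNormalsBall, Set.mem_setOf_eq, hxmid ω]
    refine forall_congr' fun k => ⟨fun h hki hkj => ?_, fun h hki hkj => ?_⟩
    · have h' := h hki hkj; rwa [hmk _ k hki hkj] at h'
    · rw [hmk _ k hki hkj]; exact h hki hkj
  have hAmem : ∀ ω : Metric.sphere (0 : V3) 1, (ω : V3) ∈ A ↔ ∀ k : Fin n, k ≠ i → k ≠ j →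
      ε ≤ ‖G.sepVec (z k).1 (mid ω i).1‖ ∧ ε ≤ ‖G.sepVec (z k).1 (mid ω j).1‖ := by
    intro ω
    rw [hAdef, hmi, hmj]
    exact Iff.rfl
  have hAmeas : MeasurableSet A := by
    rw [hAdef]
    exact NearField.measurableSet_mem_admissibleNormalsBall ε (y := fun _ : V3 => z) measurable_const i j
      (x := fun _ : V3 => (z j).1) measurable_const (ν := fun a : V3 => a) measurable_id
  /- (4) the mark on the fibre, on the ball -/
  have hmark : ∀ ω : Metric.sphere (0 : V3) 1, near (mid ω) → mark (mid ω) =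
      if V < ‖(z i).2 - (z j).2‖ then 0 else ‖(z i).2 - (z j).2‖ ^ 2 *
        (ψ s (z j).1 (z i).2 (z j).2 ω - admissibleCosineMean A ((z i).2 - (z j).2) (ψ s (z j).1 (z i).2 (z j).2)) := by
    intro ω hn
    show (if near (mid ω) then _ else (0 : ℝ)) = _
    rw [if_pos hn, hAfib ω, hxmid ω, hsep ω, inv_smul_smul₀ hε0.ne', hmi, hmj]
  /- (5) the two zero cases: no third centre in the ball, or a fast pair -/
  by_cases hnz : ∃ k : Fin n, k ≠ i ∧ k ≠ j ∧ ‖G.sepVec (z k).1 (z j).1‖ ≤ 3 * ε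
  swap
  · have hm0 : ∀ ω : Metric.sphere (0 : V3) 1, mark (mid ω) = 0 := fun ω => if_neg fun h => hnz ((hnear ω).1 h)
    refine lintegral_congr fun ω => ?_
    simp only [Set.indicator_apply, hm0 ω, neg_zero]
  have hn : ∀ ω : Metric.sphere (0 : V3) 1, near (mid ω) := fun ω => (hnear ω).2 hnz
  by_cases hV : V < ‖(z i).2 - (z j).2‖
  · have hm0 : ∀ ω : Metric.sphere (0 : V3) 1, mark (mid ω) = 0 := fun ω => by rw [hmark ω (hn ω), if_pos hV]
    refine lintegral_congr fun ω => ?_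
    simp only [Set.indicator_apply, hm0 ω, neg_zero]
  obtain ⟨c, hc⟩ : ∃ c : ℝ, c = admissibleCosineMean A ((z i).2 - (z j).2) (ψ s (z j).1 (z i).2 (z j).2) := ⟨_, rfl⟩
  have hm1 : ∀ ω : Metric.sphere (0 : V3) 1, mark (mid ω) = ‖(z i).2 - (z j).2‖ ^ 2 * (ψ s (z j).1 (z i).2 (z j).2 ω - c) :=
    fun ω => by rw [hmark ω (hn ω), if_neg hV, hc]
  /- (6) on the fibre the hard-core constraint factorises: `1_D(mid ω) = 1_{D₀}(z) 1_A(ω)` -/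
  have hD : ∀ ω : Metric.sphere (0 : V3) 1, mid ω ∈ hardSphereDomain G n ε ↔
      (∀ k l : Fin n, k ≠ l → k ≠ i → k ≠ j → l ≠ i → l ≠ j → ε ≤ ‖G.sepVec (z k).1 (z l).1‖) ∧ (ω : V3) ∈ A := by
    intro ω
    rw [mem_hardSphereDomain, hAmem ω]
    refine ⟨fun h => ⟨fun k l hkl hki hkj hli hlj => ?_, fun k hki hkj => ⟨?_, ?_⟩⟩, ?_⟩
    · have h' := h k l hkl; rwa [hmk _ k hki hkj, hmk _ l hli hlj] at h'
    · have h' := h k i hki; rwa [hmk _ k hki hkj] at h'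
    · have h' := h k j hkj; rwa [hmk _ k hki hkj] at h'
    · rintro ⟨h0, hA⟩ k l hkl
      by_cases hki : k = i
      · rw [hki] at hkl ⊢
        by_cases hlj : l = j
        · rw [hlj, hεn ω]
        · have hli : l ≠ i := fun h => hkl h.symm
          rw [hmk _ l hli hlj]
          exact (hA l hli hlj).1.trans_eq (Torus.euclidDist_comm _ _)
      · by_cases hkj : k = j
        · rw [hkj] at hkl ⊢
          by_cases hli : l = i
          · rw [hli, hεn' ω]
          · have hlj : l ≠ j := fun h => hkl h.symm
            rw [hmk _ l hli hlj]
            exact (hA l hli hlj).2.trans_eq (Torus.euclidDist_comm _ _)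
        · rw [hmk _ k hki hkj]
          by_cases hli : l = i
          · rw [hli]; exact (hA k hki hkj).1
          · by_cases hlj : l = j
            · rw [hlj]; exact (hA k hki hkj).2
            · rw [hmk _ l hli hlj]; exact h0 k l hkl hki hkj hli hlj
  by_cases hP : ∀ k l : Fin n, k ≠ l → k ≠ i → k ≠ j → l ≠ i → l ≠ j → ε ≤ ‖G.sepVec (z k).1 (z l).1‖
  swap
  · /- (7) the fibre violates an `ω`-free hard-core constraint: both sides vanish -/
    have hout : ∀ ω : Metric.sphere (0 : V3) 1, mid ω ∉ hardSphereDomain G n ε := fun ω h => hP ((hD ω).1 h).1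
    refine lintegral_congr fun ω => ?_
    rw [Set.indicator_of_notMem (hout ω), Set.indicator_of_notMem (hout ω)]
  /- (8) the admissible fibre: `1_D(mid ω) = 1_A(ω)`; pull out the `ω`-free Gibbs weight and centre -/
  obtain ⟨W, hW⟩ : ∃ W : ℝ≥0∞, W = ENNReal.ofReal ((canonicalPartition G ε n
      (localGibbsProfile (fun _ => 1) (fun _ => 0) (fun _ => θe)))⁻¹ *
        tensorPow n (localGibbsProfile (fun _ => 1) (fun _ => 0) (fun _ => θe)) z) := ⟨_, rfl⟩
  have hWtop : W ≠ ∞ := hW ▸ ENNReal.ofReal_ne_top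
  have hρ : ∀ ω : Metric.sphere (0 : V3) 1, mid ω ∈ hardSphereDomain G n ε → ρ (mid ω) = W := fun ω hin => by
    rw [hW]
    show ENNReal.ofReal (canonicalDensity G ε n _ (mid ω)) = _
    rw [canonicalDensity, Set.indicator_of_mem hin, tensorPow_localGibbsProfile_const, tensorPow_localGibbsProfile_const]
    simp only [hmv]
  have hLR : ∀ ω : Metric.sphere (0 : V3) 1,
      ((hardSphereDomain G n ε).indicator (fun y => ρ y * ENNReal.ofReal (mark y)) (mid ω) =
        W * ENNReal.ofReal (‖(z i).2 - (z j).2‖ ^ 2 * (if (ω : V3) ∈ A then ψ s (z j).1 (z i).2 (z j).2 ω - c else 0))) ∧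
      (hardSphereDomain G n ε).indicator (fun y => ρ y * ENNReal.ofReal (-mark y)) (mid ω) =
        W * ENNReal.ofReal (-(‖(z i).2 - (z j).2‖ ^ 2 * (if (ω : V3) ∈ A then ψ s (z j).1 (z i).2 (z j).2 ω - c else 0))) := by
    intro ω
    by_cases hω : (ω : V3) ∈ A
    · have hin : mid ω ∈ hardSphereDomain G n ε := (hD ω).2 ⟨hP, hω⟩
      simp only [Set.indicator_of_mem hin, if_pos hω, hρ ω hin, hm1 ω, and_self]
    · have hout : mid ω ∉ hardSphereDomain G n ε := fun h => hω ((hD ω).1 h).2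
      simp only [Set.indicator_of_notMem hout, if_neg hω, mul_zero, neg_zero, ENNReal.ofReal_zero, and_self]
  have hcomm : ∀ x y : ℝ≥0∞, x * (W * y) = W * (x * y) := fun x y => mul_left_comm x W y
  have hf : Measurable fun m : V3 => ψ s (z j).1 (z i).2 (z j).2 m := by
    have hg : Measurable fun m : V3 => (s, (z j).1, (z i).2, (z j).2, m) := by fun_prop
    exact hψm.comp hg
  have hcb : |c| ≤ 1 := by
    rw [hc]
    exact NearField.abs_admissibleCosineMean_le_one _ _ fun m => hψb s (z j).1 (z i).2 (z j).2 m
  have hmm : Measurable fun x : V3 => if x ∈ A then ψ s (z j).1 (z i).2 (z j).2 x - c else 0 :=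
    Measurable.ite hAmeas (hf.sub_const c) measurable_const
  have hmb : ∀ x : V3, |(if x ∈ A then ψ s (z j).1 (z i).2 (z j).2 x - c else 0)| ≤ 2 := fun x => by
    split_ifs
    · exact (abs_sub _ _).trans (by linarith [hψb s (z j).1 (z i).2 (z j).2 x, hcb])
    · rw [abs_zero]; norm_num
  simp only [hLR, hcomm]
  rw [lintegral_const_mul' W _ hWtop, lintegral_const_mul' W _ hWtop, ← neg_sub (z i).2 (z j).2]
  congr 1
  exact fibreAdm_lintegral_cosFlux_pos_eq_neg (g := (z i).2 - (z j).2)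
    (m := fun x => if x ∈ A then ψ s (z j).1 (z i).2 (z j).2 x - c else 0) hmm hmb (pow_nonneg hε0.le _) fun hg => by
      rw [hc]
      exact fibreAdm_integral_cosFlux_ite_sub_admissibleCosineMean_eq_zero hg hAmeas hf (hψb s (z j).1 (z i).2 (z j).2)

end Summit.AtomisticToContinuum.HydrodynamicLimit.Theorems.ContactAngleEquidistributionSketch

end
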